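import Summits.HodgeConjecture.HodgeConjecture.Theorems.EightfoldBlochSeedsChernCharacterOnBettiAnalytificationPullbackChern
import Summits.HodgeConjecture.HodgeConjecture.Theorems.EightfoldBlochSeedsChernCharacterOnBettiAnalytificationVectorBundle
import Literature.AlgebraicGeometry.KTheory.PullbackVectorBundle
import HarnessLib

/-!
# K1 (analytification bridge), step K1e packaged: `map_ch` for vector bundles on smooth projective varieties

Route `EightfoldBlochSeeds` / item `stmt-HodgeConjecture-19780` (`ChernCharacterOnBetti`), helper
(`--supports`). HONEST FRAMING: nothing here proves 19780 / 18880 / 18882 / 18883 / H2 / HC_AV / HC;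
no definition, no named fact.

WHAT. `exists_iso_pullback_of_comparison` / `topologicalChernCharacter_pullback_of_comparison` (K1e)
are hypothesised on data of `F` and of `g^*F` and on trivialisations `𝒪^r ≅ F|_U` of one size `r`.
For a vector bundle `F` (Mathlib `IsVectorBundle`) on a smooth projective `X` and `g : Y ⟶ X` with `Y`
smooth projective all of this exists: trivialisations of one size (`exists_free_fin_iso_of_isVectorBundle`:
`X` is irreducible, frames sharing a point have the same size), a datum of `F` (K1d), and a datum of
the vector bundle `g^*F` (`IsFiniteLocallyFree.pullback`, K1d). Hence

* `exists_analytification_pullback_of_isVectorBundle` — **data `(E, α)` of `F` and `(E', α')` of `g^*F`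
  exist, `E' ≅ g(ℂ)^*E`, `cᵢ(E') = g(ℂ)^*cᵢ(E)` and `complexBetti.map g (2k) (ch_k(E)) = ch_k(E')`** —
  the field `map_ch` of `ChernCharacterBetti` for the candidate `ch` on smooth projective varieties.

[cite: SerreGAGA1956, §3 n°9 Déf. 2 and n°11] [cite: Hartshorne1977, II.5 (p. 110)] [cite: Hirzebruch1966, §10.1]
-/

noncomputable section

-- single-problem summit (Problem = Summit): the mandated namespace repeats `HodgeConjecture`.
set_option linter.dupNamespace false

open CategoryTheory AlgebraicGeometry Bundle Topology TopologicalSpace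
open Literature.AlgebraicGeometry.Motives Literature.AlgebraicGeometry.HodgeTheory Literature.AlgebraicGeometry.Modules
open Literature.AlgebraicTopology.SingularHomology Literature.AlgebraicTopology.CharacteristicClasses

namespace Summit.HodgeConjecture.HodgeConjecture.Theorems

variable {n m : ℕ} {X Y : SchemeOver ℂ} {F : X.left.Modules}

/-- **On an irreducible scheme a vector bundle has trivialisations `𝒪^r ≅ F|_U` of ONE size `r` near
every point** (finite local freeness, Stacks 01C6, and invariance of the size of frames sharing a
point, `frame_card_eq`). [cite: StacksProject, Tag 01C6] -/
theorem exists_free_fin_iso_of_isVectorBundle [IrreducibleSpace X.left] (hF : IsVectorBundle F) :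
    ∃ r : ℕ, ∀ x : X.left, ∃ (U : X.left.Opens) (_ : SheafOfModules.free (Fin r) ≅ F.over U), x ∈ U := by
  have hfl := isFiniteLocallyFree_of_isVectorBundle hF
  choose U hxU I hI e using hfl
  haveI : ∀ x, Fintype (I x) := fun x ↦ @Fintype.ofFinite _ (hI x)
  obtain ⟨x₀⟩ := (inferInstance : Nonempty X.left)
  refine ⟨Fintype.card (I x₀), fun x ↦ ?_⟩
  obtain ⟨y, hy₀, hy⟩ := nonempty_preirreducible_inter (U x₀).2 (U x).2 ⟨x₀, hxU x₀⟩ ⟨x, hxU x⟩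
  have hcard : Fintype.card (I x) = Fintype.card (I x₀) :=
    frame_card_eq (isSectionFrame_basisSection (e x).some (Fintype.equivFin (I x)))
      (isSectionFrame_basisSection (e x₀).some (Fintype.equivFin (I x₀))) hy hy₀
  exact ⟨U x, ((SheafOfModules.freeFunctor (R := X.left.ringCatSheaf.over (U x))).mapIso
    ((Fintype.equivFin (I x)).trans (finCongr hcard)).toIso).symm ≪≫ (e x).some, hxU x⟩

/-- **`map_ch` for vector bundles, packaged**: for `g : Y ⟶ X` between smooth projective complex
varieties and a vector bundle `F` on `X` there are analytification data `(E, α)` of `F` and `(E', α')`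
of `g^*F` (of one rank `r`) with `E' ≅ g(ℂ)^*E`, `cᵢ(E') = g(ℂ)^* cᵢ(E)` and
`complexBetti.map g (2k) (ch_k(E)) = ch_k(E')` for all `i`, `k`. [cite: SerreGAGA1956, §3 n°9 Déf. 2 and n°11]
[cite: HusemollerFibreBundles1994, Ch. 17 §3 (C₁)] [cite: Hirzebruch1966, §10.1] -/
theorem exists_analytification_pullback_of_isVectorBundle (hX : IsSmoothProjective n X) (hY : IsSmoothProjective m Y)
    (g : Y ⟶ X) (hF : IsVectorBundle F) :
    ∃ (r : ℕ) (E : ComplexVectorBundle.{0, 0} (ComplexPoints X))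
      (α : ∀ U : X.left.Opens, Γ(F, U) → ∀ P : ComplexPoints X, E.E P)
      (E' : ComplexVectorBundle.{0, 0} (ComplexPoints Y))
      (α' : ∀ U' : Y.left.Opens, Γ((Scheme.Modules.pullback g.left).obj F, U') → ∀ Q : ComplexPoints Y, E'.E Q),
      E.rank = r ∧ E'.rank = r ∧
      (∀ x : X.left, ∃ (U : X.left.Opens) (s : Fin r → Γ(F, U)), x ∈ U ∧ IsSectionFrame F U s) ∧
      (∀ (U : X.left.Opens) (σ : Γ(F, U)),
          ContinuousOn (fun P ↦ (⟨P, α U σ P⟩ : TotalSpace E.F E.E)) {P | P.pt ∈ U}) ∧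
      (∀ (U : X.left.Opens) (t : Fin r → Γ(F, U)), IsSectionFrame F U t → ∀ P : ComplexPoints X,
          P.pt ∈ U → LinearIndependent ℂ (fun j ↦ α U (t j) P) ∧
            ⊤ ≤ Submodule.span ℂ (Set.range fun j ↦ α U (t j) P)) ∧
      (∀ (U' : Y.left.Opens) (σ : Γ((Scheme.Modules.pullback g.left).obj F, U')),
          ContinuousOn (fun Q ↦ (⟨Q, α' U' σ Q⟩ : TotalSpace E'.F E'.E)) {Q | Q.pt ∈ U'}) ∧
      (∀ (U' : Y.left.Opens) (t : Fin r → Γ((Scheme.Modules.pullback g.left).obj F, U')),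
          IsSectionFrame ((Scheme.Modules.pullback g.left).obj F) U' t → ∀ Q : ComplexPoints Y,
          Q.pt ∈ U' → LinearIndependent ℂ (fun j ↦ α' U' (t j) Q) ∧
            ⊤ ≤ Submodule.span ℂ (Set.range fun j ↦ α' U' (t j) Q)) ∧
      (∃ i : (E.pullback (AlgPoints.mapContinuous g)).Iso E',
        ∀ (U : X.left.Opens) (σ : Γ(F, U)) (Q : ComplexPoints Y), (AlgPoints.map g Q).pt ∈ U →
          i.equiv Q (α U σ (AlgPoints.map g Q)) = α' (g.left ⁻¹ᵁ U) (unitSection g.left F U σ) Q) ∧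
      (∀ i : ℕ, chernClassZ E' i = singularCohomology.map ℤ ℤ (AlgPoints.mapContinuous g) (2 * i) (chernClassZ E i)) ∧
      (∀ k : ℕ, complexBetti.map g (2 * k) (theChernClassTheory.topologicalChernCharacter ℂ E k) =
        theChernClassTheory.topologicalChernCharacter ℂ E' k) := by
  haveI := IsSmoothProjective.isIntegral_holds hX
  haveI := IsSmoothProjective.isIntegral_holds hY
  -- trivialisations of one size, data of `F` and of `g^*F`
  obtain ⟨r, hFr⟩ := exists_free_fin_iso_of_isVectorBundle hF
  obtain ⟨r₁, E, α, hrank, hfr, hadd, hsmul, hres, hcont, hframe⟩ :=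
    exists_topologicalAnalytification_of_isVectorBundle hX hF
  have hF' : IsVectorBundle ((Scheme.Modules.pullback g.left).obj F) :=
    ((isFiniteLocallyFree_of_isVectorBundle hF).pullback g.left).isVectorBundle
  obtain ⟨r₂, E', α', hrank', hfr', hadd', hsmul', hres', hcont', hframe'⟩ :=
    exists_topologicalAnalytification_of_isVectorBundle hY hF'
  -- all frame sizes agree with `r`
  obtain ⟨x₀⟩ := (inferInstance : Nonempty X.left)
  obtain rfl : r₁ = r := by
    obtain ⟨U, e, hx⟩ := hFr x₀
    obtain ⟨U₁, s₁, hx₁, hs₁⟩ := hfr x₀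
    exact frame_card_eq hs₁ (isSectionFrame_basisSection e (Equiv.refl _)) hx₁ hx
  obtain ⟨y₀⟩ := (inferInstance : Nonempty Y.left)
  obtain rfl : r₂ = r₁ := by
    obtain ⟨U, e, hx⟩ := hFr (g.left.base y₀)
    obtain ⟨U₂, s₂, hy₂, hs₂⟩ := hfr' y₀
    exact frame_card_eq hs₂ (isSectionFrame_unitSection g e (Equiv.refl _)) hy₂ hx
  obtain ⟨i, hi⟩ := exists_iso_pullback_of_comparison g hFr E E' α α' hadd hsmul hres hcont hframe
    hadd' hsmul' hres' hcont' hframe'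
  exact ⟨r₂, E, α, E', α', hrank, hrank', hfr, hcont, hframe, hcont', hframe', ⟨i, hi⟩,
    fun i ↦ chernClassZ_pullback_of_comparison g hX hY hFr E E' α α' hadd hsmul hres hcont hframe
      hadd' hsmul' hres' hcont' hframe' i,
    fun k ↦ topologicalChernCharacter_pullback_of_comparison g hX hY hFr E E' α α' hadd hsmul hres hcont hframe
      hadd' hsmul' hres' hcont' hframe' k⟩

end Summit.HodgeConjecture.HodgeConjecture.Theorems

end
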